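import Mathlib
import Summits.RiemannHypothesis.RiemannHypothesis.Theorems.DensityLadderSeparatedTowerWindows
import Summits.RiemannHypothesis.RiemannHypothesis.Theorems.DensityLadderSeparatedTowerSchur
import Summits.RiemannHypothesis.RiemannHypothesis.Theorems.DensityLadderSeparatedTowerWindowSums
import Summits.RiemannHypothesis.RiemannHypothesis.Theorems.DensityLadderSeparatedTowerUpperPieces
import HarnessLib

/-!
# `DensityLadder.SeparatedTowerDensityLine` (item stmt-RiemannHypothesis-24918) — the far tail
# (zeros with `|Im ρ| > T⁴`) of the zero sum is `O(1)` (UPPER half of stub S1)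

LINE L57 «sieve sight above the density line» (rh-idea-10 g1), crux K1 `SeparatedTowerDensityLine`,
stub S1 (assembly skeleton `S1-ASSEMBLY-SKELETON.lean` on stmt-RiemannHypothesis-24918).  At height
`T` (`A = 4(T+1)`, `η = 1/A`) the transform decays like `‖ĉ_ρ‖ ≤ (9/2)M₂A²/γ²`; for the far zeros
`|γ| > T⁴` one has `A² ≤ 64√|γ|`, so `m_i‖ĉ_i‖` is dominated through the unit windows by the
T-INDEPENDENT profile `(|n|+2)^{3/4}/(|n|−1)²` (tame window masses `≤ C log(|n|+2) ≤ 4C(|n|+2)^{1/4}`,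
tower masses `≤ B(1/g+1)`).  Hence `Σ_{|γ_i|>T⁴} m_i‖ĉ_i‖ ≤ C_R` with `C_R` independent of `T`
(finite partial sums + `sum_int_le_two_tsum_nat` + `summable_far_profile`).
Cell rh-split, seat rh-split-prover-l57 g0.  RH-free, ζ-free; FRONTIER bookkeeping; nothing here
bears on the truth of RH.
-/

set_option linter.dupNamespace false

noncomputable section

open Filter Set Finset
open scoped Real

namespace Summit.RiemannHypothesis.RiemannHypothesis.Theorems.DensityLadderSeparatedTowerFarTail

open Summit.RiemannHypothesis.RiemannHypothesis.Theorems.DensityLadderSeparatedTowerWindows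
open Summit.RiemannHypothesis.RiemannHypothesis.Theorems.DensityLadderSeparatedTowerSchur
open Summit.RiemannHypothesis.RiemannHypothesis.Theorems.DensityLadderSeparatedTowerWindowSums
open Summit.RiemannHypothesis.RiemannHypothesis.Theorems.DensityLadderSeparatedTowerUpperPieces

/-- **The far tail is `O(1)`.**  Let `m ≥ 0`, let the zeros with `Re ρ ≤ 1/2` have unit-window
masses `≤ C log(|t|+2)` (`C ≥ 0`), the zeros with `Re ρ > 1/2` have `m ≤ B` (`B ≥ 0`) and pairwise
`g`-separated ordinates, and let `0 ≤ f_i ≤ (9/2)M₂(4(T+1))²/γ_i²` whenever `|γ_i| > T⁴`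
(`T ≥ 3`, `M₂ ≥ 0`).  Then `Σ_{|γ_i| > T⁴} m_i f_i` converges and is at most
`(4C + B(1/g+1)) · 288M₂ · 2K_far`, `K_far = Σ_{j≥2} (j+2)^{3/4}/(j−1)²`. [folklore] -/
theorem far_tail_le {ι : Type} (m : ι → ℝ) (ρ : ι → ℂ) (hm : ∀ i, 0 ≤ m i)
    {C B g M₂ T : ℝ} (hC : 0 ≤ C) (hB : 0 ≤ B) (hg : 0 < g) (hM₂ : 0 ≤ M₂) (hT : 3 ≤ T)
    (htame : ∀ t : ℝ, {i : ι | (ρ i).re ≤ 1 / 2 ∧ |(ρ i).im - t| ≤ 1}.Finite ∧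
      (∑ᶠ i ∈ {i : ι | (ρ i).re ≤ 1 / 2 ∧ |(ρ i).im - t| ≤ 1}, m i) ≤ C * Real.log (|t| + 2))
    (htow : ∀ i, 1 / 2 < (ρ i).re → m i ≤ B)
    (hsep : ∀ i j : ι, 1 / 2 < (ρ i).re → 1 / 2 < (ρ j).re → i ≠ j → g ≤ |(ρ i).im - (ρ j).im|)
    (f : ι → ℝ) (hf0 : ∀ i, 0 ≤ f i)
    (hfdec : ∀ i, T ^ 4 < |(ρ i).im| → f i ≤ 9 / 2 * M₂ * (4 * (T + 1)) ^ 2 / (ρ i).im ^ 2) :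
    Summable (fun i : ι ↦ if T ^ 4 < |(ρ i).im| then m i * f i else 0) ∧
    ∑' i : ι, (if T ^ 4 < |(ρ i).im| then m i * f i else 0) ≤
      (4 * C + B * (1 / g + 1)) * (288 * M₂) *
        (2 * ∑' j : ℕ, (if j ≤ 1 then (0 : ℝ) else ((j : ℝ) + 2) ^ (3 / 4 : ℝ) / ((j : ℝ) - 1) ^ 2)) := by
  classical
  set G : ℕ → ℝ := fun j ↦ if j ≤ 1 then (0 : ℝ) else ((j : ℝ) + 2) ^ (3 / 4 : ℝ) / ((j : ℝ) - 1) ^ 2 with hG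
  have hG0 : ∀ j, 0 ≤ G j := fun j ↦ by
    rw [hG]; simp only; split_ifs
    · exact le_rfl
    · positivity
  have hGs : Summable G := summable_far_profile
  set Cw : ℝ := 4 * C + B * (1 / g + 1) with hCw
  have hCw0 : 0 ≤ Cw := by positivity
  -- the dominating window functions
  set w : ℤ → ℝ := fun n ↦ Cw * (|(n : ℝ)| + 2) ^ (1 / 4 : ℝ) with hw
  set H : ℤ → ℝ := fun n ↦ if (|(n : ℝ)|) < 2 then 0 else 288 * M₂ * (|(n : ℝ)| + 2) ^ (1 / 2 : ℝ) / ((|(n : ℝ)| - 1) ^ 2)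
    with hH
  have hH0 : ∀ n, 0 ≤ H n := fun n ↦ by
    rw [hH]; simp only; split_ifs
    · exact le_rfl
    · positivity
  -- `w n * H n ≤ Cw * 288 M₂ * G |n|`
  have hwH : ∀ n : ℤ, w n * H n ≤ Cw * (288 * M₂) * G n.natAbs := by
    intro n
    have habs : ((n.natAbs : ℕ) : ℝ) = |(n : ℝ)| := by rw [Nat.cast_natAbs, Int.cast_abs]
    by_cases h2 : |(n : ℝ)| < 2
    · have : H n = 0 := by rw [hH]; simp only; rw [if_pos h2]
      rw [this, mul_zero]
      exact mul_nonneg (by positivity) (hG0 _)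
    · have hn2 : ¬ n.natAbs ≤ 1 := by
        intro h; apply h2
        have : ((n.natAbs : ℕ) : ℝ) ≤ 1 := by exact_mod_cast h
        rw [habs] at this; linarith
      have hGn : G n.natAbs = (|(n : ℝ)| + 2) ^ (3 / 4 : ℝ) / ((|(n : ℝ)| - 1) ^ 2) := by
        rw [hG]; simp only; rw [if_neg hn2, habs]
      have hHn : H n = 288 * M₂ * (|(n : ℝ)| + 2) ^ (1 / 2 : ℝ) / ((|(n : ℝ)| - 1) ^ 2) := by
        rw [hH]; simp only; rw [if_neg h2]
      rw [hGn, hHn, hw]; simp only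
      have hpos : 0 < |(n : ℝ)| + 2 := by positivity
      have e : (|(n : ℝ)| + 2) ^ (1 / 4 : ℝ) * (|(n : ℝ)| + 2) ^ (1 / 2 : ℝ) = (|(n : ℝ)| + 2) ^ (3 / 4 : ℝ) := by
        rw [← Real.rpow_add hpos]; norm_num
      rw [← e]
      apply le_of_eq
      ring
  -- the far zeros: `f_i ≤ H ⌊γ_i⌋` and window masses `≤ w n`
  have hT1 : (1 : ℝ) ≤ T := by linarith
  have hT4 : (81 : ℝ) ≤ T ^ 4 := by nlinarith [sq_nonneg T, sq_nonneg (T ^ 2 - 9)]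
  have hfH : ∀ i, T ^ 4 < |(ρ i).im| → f i ≤ H ⌊(ρ i).im⌋ := by
    intro i hi
    set n : ℤ := ⌊(ρ i).im⌋ with hn
    have hfl := Int.floor_le ((ρ i).im)
    have hfl2 := Int.lt_floor_add_one ((ρ i).im)
    have hd : |((n : ℝ)) - (ρ i).im| ≤ 1 := abs_le.2 ⟨by rw [hn]; linarith, by rw [hn]; linarith⟩
    have h1 : |((n : ℝ))| - 1 ≤ |(ρ i).im| := by
      have := abs_sub_abs_le_abs_sub ((n : ℝ)) (ρ i).im; linarith
    have h2 : |(ρ i).im| ≤ |((n : ℝ))| + 1 := by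
      have := abs_sub_abs_le_abs_sub (ρ i).im ((n : ℝ)); rw [abs_sub_comm] at hd; linarith
    have hn80 : (80 : ℝ) ≤ |((n : ℝ))| := by linarith
    have hγ0 : 0 ≤ |(ρ i).im| := abs_nonneg _
    rw [hH]; simp only
    rw [if_neg (by linarith)]
    refine (hfdec i hi).trans ?_
    -- `(4(T+1))² ≤ 64 √|γ| ≤ 64 (|n|+2)^{1/2}` and `γ² ≥ (|n|-1)²`
    have hA2 : (4 * (T + 1)) ^ 2 ≤ 64 * (|(n : ℝ)| + 2) ^ (1 / 2 : ℝ) := by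
      have hsq : T ^ 2 ≤ Real.sqrt (|(ρ i).im|) := by
        have e : Real.sqrt (T ^ 4) = T ^ 2 := by
          rw [show T ^ 4 = (T ^ 2) ^ 2 by ring, Real.sqrt_sq (by positivity)]
        rw [← e]
        exact Real.sqrt_le_sqrt hi.le
      have hsq2 : Real.sqrt (|(ρ i).im|) ≤ (|(n : ℝ)| + 2) ^ (1 / 2 : ℝ) := by
        rw [Real.sqrt_eq_rpow]
        exact Real.rpow_le_rpow (abs_nonneg _) (by linarith) (by norm_num)
      nlinarith [sq_nonneg (T - 1)]
    have hγ2 : (|(n : ℝ)| - 1) ^ 2 ≤ (ρ i).im ^ 2 := by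
      rw [← sq_abs ((ρ i).im)]
      exact pow_le_pow_left₀ (by linarith) h1 2
    have hden : 0 < (|(n : ℝ)| - 1) ^ 2 := by nlinarith
    calc 9 / 2 * M₂ * (4 * (T + 1)) ^ 2 / (ρ i).im ^ 2
        ≤ 9 / 2 * M₂ * (64 * (|(n : ℝ)| + 2) ^ (1 / 2 : ℝ)) / (ρ i).im ^ 2 := by
          gcongr
      _ ≤ 9 / 2 * M₂ * (64 * (|(n : ℝ)| + 2) ^ (1 / 2 : ℝ)) / (|(n : ℝ)| - 1) ^ 2 :=
          div_le_div_of_nonneg_left (by positivity) hden hγ2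
      _ = 288 * M₂ * (|(n : ℝ)| + 2) ^ (1 / 2 : ℝ) / (|(n : ℝ)| - 1) ^ 2 := by ring
  -- window masses of any finite far family
  have hwin : ∀ (Af : Finset ι), (∀ i ∈ Af, T ^ 4 < |(ρ i).im|) →
      ∀ n : ℤ, ∑ i ∈ Af.filter (fun i ↦ ⌊(ρ i).im⌋ = n), m i ≤ w n := by
    intro Af _ n
    have hsplit := Finset.sum_filter_add_sum_filter_not (Af.filter (fun i ↦ ⌊(ρ i).im⌋ = n))
      (fun i ↦ (ρ i).re ≤ 1 / 2) m
    rw [← hsplit, Finset.filter_filter, Finset.filter_filter]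
    have e1 : Af.filter (fun i ↦ ⌊(ρ i).im⌋ = n ∧ (ρ i).re ≤ 1 / 2) =
        (Af.filter (fun i ↦ (ρ i).re ≤ 1 / 2)).filter (fun i ↦ ⌊(ρ i).im⌋ = n) := by
      rw [Finset.filter_filter]; congr 1; ext i; tauto
    have e2 : Af.filter (fun i ↦ ⌊(ρ i).im⌋ = n ∧ ¬ (ρ i).re ≤ 1 / 2) =
        (Af.filter (fun i ↦ 1 / 2 < (ρ i).re)).filter (fun i ↦ ⌊(ρ i).im⌋ = n) := by
      rw [Finset.filter_filter]; congr 1; ext i; constructor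
      · rintro ⟨h1, h2⟩; exact ⟨not_le.1 h2, h1⟩
      · rintro ⟨h1, h2⟩; exact ⟨h2, not_le.2 h1⟩
    rw [e1, e2]
    have ht := tame_window_mass_le (fun i ↦ (ρ i).im) m hm (fun i ↦ (ρ i).re ≤ 1 / 2) htame
      (Af.filter (fun i ↦ (ρ i).re ≤ 1 / 2)) (fun i hi ↦ (Finset.mem_filter.1 hi).2) n
    have htw := tower_window_mass_le (fun i ↦ (ρ i).im) m (fun i ↦ 1 / 2 < (ρ i).re) hg hB
      htow hsep (Af.filter (fun i ↦ 1 / 2 < (ρ i).re)) (fun i hi ↦ (Finset.mem_filter.1 hi).2) n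
    -- `C log(|n|+2) + B(1/g+1) ≤ w n`
    have hpos : 0 < |(n : ℝ)| + 2 := by positivity
    have hr1 : 1 ≤ (|(n : ℝ)| + 2) ^ (1 / 4 : ℝ) := Real.one_le_rpow (by linarith [abs_nonneg (n : ℝ)]) (by norm_num)
    have hlog : Real.log (|(n : ℝ)| + 2) ≤ 4 * (|(n : ℝ)| + 2) ^ (1 / 4 : ℝ) := by
      have := Real.log_le_rpow_div hpos.le (by norm_num : (0 : ℝ) < 1 / 4)
      linarith
    rw [hw]; simp only; rw [hCw]
    nlinarith [mul_le_mul_of_nonneg_left hlog hC, mul_le_mul_of_nonneg_left hr1 (by positivity : 0 ≤ B * (1 / g + 1))]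
  -- partial sums
  set F : ι → ℝ := fun i ↦ if T ^ 4 < |(ρ i).im| then m i * f i else 0 with hF
  have hF0 : ∀ i, 0 ≤ F i := fun i ↦ by
    rw [hF]; simp only; split_ifs
    · exact mul_nonneg (hm i) (hf0 i)
    · exact le_rfl
  have hpartial : ∀ u : Finset ι, ∑ i ∈ u, F i ≤ Cw * (288 * M₂) * (2 * ∑' j, G j) := by
    intro u
    set Af := u.filter (fun i ↦ T ^ 4 < |(ρ i).im|) with hAf
    have hAfP : ∀ i ∈ Af, T ^ 4 < |(ρ i).im| := fun i hi ↦ (Finset.mem_filter.1 hi).2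
    have h1 : ∑ i ∈ u, F i = ∑ i ∈ Af, m i * f i := by rw [hAf, Finset.sum_filter]
    rw [h1]
    have h2 := sum_weight_window_le Af (fun i ↦ (ρ i).im) m f hm H hH0 (fun i hi ↦ hfH i (hAfP i hi)) w
      (hwin Af hAfP)
    refine h2.trans ?_
    calc ∑ n ∈ Af.image (fun i ↦ ⌊(ρ i).im⌋), w n * H n
        ≤ ∑ n ∈ Af.image (fun i ↦ ⌊(ρ i).im⌋), Cw * (288 * M₂) * G n.natAbs := Finset.sum_le_sum fun n _ ↦ hwH n
      _ = Cw * (288 * M₂) * ∑ n ∈ Af.image (fun i ↦ ⌊(ρ i).im⌋), G n.natAbs := by rw [Finset.mul_sum]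
      _ ≤ Cw * (288 * M₂) * (2 * ∑' j, G j) :=
          mul_le_mul_of_nonneg_left (sum_int_le_two_tsum_nat G hG0 hGs _) (by positivity)
  exact ⟨summable_of_sum_le hF0 hpartial, Real.tsum_le_of_sum_le hF0 hpartial⟩

end Summit.RiemannHypothesis.RiemannHypothesis.Theorems.DensityLadderSeparatedTowerFarTail

end
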